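import Mathlib.LinearAlgebra.Matrix.Kronecker
import Literature.Computability.QuantumComplexity.ExactQuantumQuery
import Literature.Computability.QuantumComplexity.GroverSearch
import HarnessLib

/-!
# Sub-functions cost no more queries: `Q_ε(f ∘ lift_τ) ≤ Q_ε(f)` (restriction / padding / relabelling)

Topic `Computability/QuantumComplexity`. In the tree's query model `QQueryAlg` [BealsEtAl2001, §2]
(`QuantumQuery.lean`: basis `Fin N × Bool × W`, bit-flip oracle `O_x |i, b, z⟩ = |i, b ⊕ x_i, z⟩`,
`Q_ε = quantumQueryComplexity ε`), this file types the step that A. Ambainis, J. Iraids, J. Smotrovs,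
*Exact quantum query complexity of EXACT and THRESHOLD*, TQC 2013 [AmbainisIraidsSmotrovs2013] use in the
proofs of their Corollaries 1 and 2 (held text `paper:arxiv-1302.1235`, p. 5 L51–57, p. 6 L43–52):

> *Proof (of Cor. 1).* Assume that `k < n/2`. […] Then we append the input `x` with `n − 2k` ones producing
> `x'` and call `EXACT_{n−k}^{2n−2k}(x')`.

i.e. **an algorithm for `f` on `M` variables yields an algorithm with the same number of queries for every
sub-function of `f` obtained by substituting, for each of the `M` variables, one of `N` fresh variables or a
constant** (a *variable map* `τ : Fin M → Fin N ⊕ Bool`; `liftInput τ x` is the substituted input). This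
covers padding with constants (AIS13), identification and permutation of variables, and relabelling along
`Fin M ≃ Fin N`; the printed sources treat it as evident ("we append the input … and call …"), and in the
phase-oracle model of [AmbainisIraidsSmotrovs2013, §2] it is literally a renaming of basis states. In the
tree's bit-flip model a short construction is needed, given here (`simAlg`):

* the simulator's workspace holds the whole simulated machine, `W_sim = Fin M × Bool × A.W`; the real index
  register rests at a fixed `i₀ : Fin N` and the real target rests in `|+⟩ = H|0⟩` (`hadGate`, `embedP`), on
  which every bit flip acts trivially — so a real query does nothing unless asked to;
* a simulated query at virtual index `j` with `τ j = inl i` swaps the real target with the virtual target and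
  moves the real index to `i` (the involution `swapPerm`), queries, and swaps back; with `τ j = inr c` it
  only flips the virtual target by the constant `c` (`flipPerm`); both are permutation matrices, and
  `round_embedP` is the one-line bookkeeping `F · P · O_x · P · ι(ψ) = ι(O_{lift τ x} ψ)`;
* the simulated unitaries act on the workspace only (`liftGate`, `liftGate_mulVec_embedP`);
* `simAlg_finalState` / `simAlg_acceptProb`: the simulator's acceptance probability at `x` is the simulated
  machine's at `liftInput τ x`, with the same number of queries (`simAlg_queries`).

Consequences (all for `0 ≤ ε`; for `N = 0` the left side is the junk value `0`):
`quantumQueryComplexityOn_liftInput_le` (promise version), **`quantumQueryComplexity_liftInput_le`**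
(`Q_ε(x ↦ f (liftInput τ x)) ≤ Q_ε(f)`), `quantumQueryComplexity_comp_le` (`τ = inl ∘ g`: identifying /
renaming variables), **`quantumQueryComplexity_comp_equiv`** (invariance under `Fin M ≃ Fin N`),
**`quantumQueryComplexity_append_le`** (padding: `Q_ε(x ↦ f (Fin.append x c)) ≤ Q_ε(f)`), and the
zero-query constant functions `quantumQueryComplexity_const`.

Everything is proved; no fact, instance, notation or axiom is introduced. Mathlib has no query model; the
tree had the model, its `N`-query upper bound (`ExactQuantumQuery.lean`) and congruence on a promise set
(`SymmetricPartialSpeedupLimit.quantumQueryComplexityOn_congr`), but no restriction lemma (searched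
`restrict`, `pad`, `castAdd`, `subfunction` under `Literature/Computability/QuantumComplexity`).

## References

* [AmbainisIraidsSmotrovs2013] A. Ambainis, J. Iraids, J. Smotrovs, *Exact quantum query complexity of EXACT
  and THRESHOLD*, Proc. TQC 2013 (LIPIcs 22) 263–269; arXiv:1302.1235 — §2 (model), Cor. 1 (p. 5 L51–57,
  "already given in [MJM11]" = A. Montanaro, R. Jozsa, G. Mitchison, *On exact quantum query complexity*,
  Algorithmica 71 (2015)), Cor. 2 (p. 6 L43–52), Prop. 1 (sub-functions, p. 5 L61–63).
* [BealsEtAl2001] R. Beals, H. Buhrman, R. Cleve, M. Mosca, R. de Wolf, *Quantum lower bounds by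
  polynomials*, J. ACM 48(4) (2001) 778–797 — §2 (the query model with the bit-flip oracle).
-/

noncomputable section

namespace Literature.Computability.QuantumComplexity.QueryRestriction

open Matrix Finset Literature.Computability.Cryptography
open Literature.Computability.QuantumComplexity.Grover (rhalf rhalf_mul_rhalf rhalfC_mul_rhalfC)
open scoped Kronecker

variable {N M : ℕ}

/-! ### Variable maps and substituted inputs -/

/-- The input of the `M`-variable function read through the variable map `τ`: position `j` holds the
variable `x i` when `τ j = inl i` and the constant `c` when `τ j = inr c` ("we append the input `x` with
`n − 2k` ones producing `x'`"). [cite: AmbainisIraidsSmotrovs2013, Cor. 1 (proof)] -/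
def liftInput (τ : Fin M → Fin N ⊕ Bool) (x : Fin N → Bool) : Fin M → Bool :=
  fun j => Sum.elim x id (τ j)

/-- Unfolding `liftInput`. [cite: AmbainisIraidsSmotrovs2013, Cor. 1 (proof)] -/
theorem liftInput_apply (τ : Fin M → Fin N ⊕ Bool) (x : Fin N → Bool) (j : Fin M) :
    liftInput τ x j = Sum.elim x id (τ j) := rfl

/-- A variable position reads the variable. [cite: AmbainisIraidsSmotrovs2013, Cor. 1 (proof)] -/
theorem liftInput_of_inl {τ : Fin M → Fin N ⊕ Bool} {j : Fin M} {i : Fin N} (h : τ j = Sum.inl i)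
    (x : Fin N → Bool) : liftInput τ x j = x i := by
  rw [liftInput_apply, h, Sum.elim_inl]

/-- A constant position reads the constant. [cite: AmbainisIraidsSmotrovs2013, Cor. 1 (proof)] -/
theorem liftInput_of_inr {τ : Fin M → Fin N ⊕ Bool} {j : Fin M} {c : Bool} (h : τ j = Sum.inr c)
    (x : Fin N → Bool) : liftInput τ x j = c := by
  rw [liftInput_apply, h, Sum.elim_inr, id]

/-- Without constants the substituted input is `x ∘ g`. [cite: AmbainisIraidsSmotrovs2013, Cor. 1 (proof)] -/
theorem liftInput_inl_comp (g : Fin M → Fin N) (x : Fin N → Bool) : liftInput (Sum.inl ∘ g) x = x ∘ g :=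
  rfl

/-- The constant read at a position (`false` at a variable position). [folklore] -/
def constOf : Fin N ⊕ Bool → Bool := Sum.elim (fun _ => false) id

/-- `constOf (inl i) = false`. [cite: AmbainisIraidsSmotrovs2013, Cor. 1 (proof)] -/
@[simp] theorem constOf_inl (i : Fin N) : constOf (Sum.inl i : Fin N ⊕ Bool) = false := rfl

/-- `constOf (inr c) = c`. [cite: AmbainisIraidsSmotrovs2013, Cor. 1 (proof)] -/
@[simp] theorem constOf_inr (c : Bool) : constOf (Sum.inr c : Fin N ⊕ Bool) = c := rfl

/-! ### Gates on `Fin N × Bool × V`: the resting embeddings, `H` on the real target, workspace unitaries -/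

section Generic

variable {V : Type} [Fintype V] [DecidableEq V]

/-- The simulated state `ψ` placed in the simulator: real index at `i₀`, real target in `|+⟩`
(amplitude `ψ σ / √2` at `(i₀, b, σ)` for both `b`). [folklore] -/
def embedP (i₀ : Fin N) (ψ : V → ℂ) : Fin N × Bool × V → ℂ :=
  fun s => if s.1 = i₀ then (rhalf : ℂ) * ψ s.2.2 else 0

/-- The simulated state `ψ` placed in the simulator with the real registers at the basis state `(i₀, 0)`.
[folklore] -/
def embed0 (i₀ : Fin N) (ψ : V → ℂ) : Fin N × Bool × V → ℂ :=
  fun s => if s.1 = i₀ ∧ s.2.1 = false then ψ s.2.2 else 0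

omit [Fintype V] [DecidableEq V] in
/-- Unfolding `embedP`. [cite: AmbainisIraidsSmotrovs2013, Cor. 1 (proof)] -/
@[simp] theorem embedP_apply (i₀ : Fin N) (ψ : V → ℂ) (i : Fin N) (b : Bool) (σ : V) :
    embedP i₀ ψ (i, b, σ) = if i = i₀ then (rhalf : ℂ) * ψ σ else 0 := rfl

omit [Fintype V] [DecidableEq V] in
/-- Unfolding `embed0`. [cite: AmbainisIraidsSmotrovs2013, Cor. 1 (proof)] -/
@[simp] theorem embed0_apply (i₀ : Fin N) (ψ : V → ℂ) (i : Fin N) (b : Bool) (σ : V) :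
    embed0 i₀ ψ (i, b, σ) = if i = i₀ ∧ b = false then ψ σ else 0 := rfl

/-- The Hadamard matrix on one qubit (rows `(r, r)`, `(r, −r)`, `r = 1/√2`). [folklore] -/
def hadT : Matrix Bool Bool ℂ :=
  Matrix.of fun b c => if b = true ∧ c = true then -(rhalf : ℂ) else rhalf

/-- The Hadamard matrix is unitary. [cite: NielsenChuang2010, §1.3.1 eq. (1.14)] -/
theorem hadT_mem_unitaryGroup : hadT ∈ Matrix.unitaryGroup Bool ℂ := by
  rw [Matrix.mem_unitaryGroup_iff]
  ext b b'
  simp only [Matrix.mul_apply, Matrix.star_apply, hadT, Matrix.of_apply, one_apply, Fintype.sum_bool]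
  have h := rhalfC_mul_rhalfC
  have hs : star (rhalf : ℂ) = rhalf := Complex.conj_ofReal _
  cases b <;> cases b' <;> simp [hs] <;> linear_combination (2 : ℂ) * h

/-- `H|0⟩ = |+⟩`: `H b 0 = r`. [cite: NielsenChuang2010, §1.3.1 eq. (1.14)] -/
theorem hadT_false (b : Bool) : hadT b false = rhalf := by
  simp [hadT]

/-- `H|+⟩ = |0⟩`: `Σ_c H b c · r = [b = 0]`. [cite: NielsenChuang2010, §1.3.1 eq. (1.14)] -/
theorem sum_hadT_mul_rhalf (b : Bool) : ∑ c : Bool, hadT b c * (rhalf : ℂ) = if b = false then 1 else 0 := by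
  have h := rhalfC_mul_rhalfC
  cases b
  · simp only [Fintype.sum_bool, hadT, Matrix.of_apply, Bool.false_eq_true, false_and, if_false, if_true]
    linear_combination (2 : ℂ) * h
  · simp only [Fintype.sum_bool, hadT, Matrix.of_apply, Bool.false_eq_true, and_false, and_true, if_false,
      if_true, Bool.true_eq_false]
    ring

/-- `H` on the real target: `1 ⊗ H ⊗ 1` on `Fin N × Bool × V`. [folklore] -/
def hadGate (N : ℕ) (V : Type) [Fintype V] [DecidableEq V] : Matrix.unitaryGroup (Fin N × Bool × V) ℂ :=
  ⟨(1 : Matrix (Fin N) (Fin N) ℂ) ⊗ₖ (hadT ⊗ₖ (1 : Matrix V V ℂ)),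
    Matrix.kronecker_mem_unitary (Submonoid.one_mem _)
      (Matrix.kronecker_mem_unitary hadT_mem_unitaryGroup (Submonoid.one_mem _))⟩

/-- `1 ⊗ H ⊗ 1` acts on the target index only. [cite: NielsenChuang2010, §1.3.1 eq. (1.14)] -/
theorem hadGate_mulVec_apply (v : Fin N × Bool × V → ℂ) (s : Fin N × Bool × V) :
    ((hadGate N V).1 *ᵥ v) s = ∑ c : Bool, hadT s.2.1 c * v (s.1, c, s.2.2) := by
  obtain ⟨l, b, w⟩ := s
  rw [hadGate]
  simp only [mulVec, dotProduct, Fintype.sum_prod_type]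
  rw [Finset.sum_eq_single l]
  · refine Finset.sum_congr rfl fun c _ => ?_
    rw [Finset.sum_eq_single w]
    · simp
    · intro w' _ hw'
      simp [Ne.symm hw']
    · intro h; exact absurd (Finset.mem_univ _) h
  · intro l' _ hl'
    refine Finset.sum_eq_zero fun c _ => Finset.sum_eq_zero fun w' _ => ?_
    simp [Matrix.one_apply, Ne.symm hl']
  · intro h; exact absurd (Finset.mem_univ _) h

/-- `(1 ⊗ H ⊗ 1)|i₀, 0, σ₀⟩ = |i₀, +, σ₀⟩`: the first Hadamard puts the real target into `|+⟩`. [cite: NielsenChuang2010, §1.3.1 eq. (1.14)] -/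
theorem hadGate_mulVec_single (i₀ : Fin N) (σ₀ : V) :
    (hadGate N V).1 *ᵥ Pi.single (i₀, false, σ₀) 1 = embedP i₀ (Pi.single σ₀ 1) := by
  funext ⟨i, b, σ⟩
  rw [hadGate_mulVec_apply, embedP_apply, Fintype.sum_bool]
  by_cases hi : i = i₀
  · subst hi
    by_cases hσ : σ = σ₀
    · subst hσ
      rw [if_pos rfl, Pi.single_eq_same, Pi.single_eq_same, Pi.single_eq_of_ne (by simp), hadT_false]
      simp
    · rw [if_pos rfl, Pi.single_eq_of_ne hσ, Pi.single_eq_of_ne (by simp [hσ]),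
        Pi.single_eq_of_ne (by simp [hσ])]
      simp
  · rw [if_neg hi, Pi.single_eq_of_ne (by simp [hi]), Pi.single_eq_of_ne (by simp [hi])]
    simp

/-- `(1 ⊗ H ⊗ 1)` sends the `|+⟩`-resting embedding to the `|0⟩`-resting one. [cite: NielsenChuang2010, §1.3.1 eq. (1.14)] -/
theorem hadGate_mulVec_embedP (i₀ : Fin N) (ψ : V → ℂ) :
    (hadGate N V).1 *ᵥ embedP i₀ ψ = embed0 i₀ ψ := by
  funext ⟨i, b, σ⟩
  rw [hadGate_mulVec_apply, embed0_apply]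
  simp only [embedP_apply]
  by_cases hi : i = i₀
  · subst hi
    simp only [if_true, true_and]
    have : ∀ c : Bool, hadT b c * ((rhalf : ℂ) * ψ σ) = hadT b c * (rhalf : ℂ) * ψ σ := fun c => by ring
    rw [Finset.sum_congr rfl fun c _ => this c, ← Finset.sum_mul, sum_hadT_mul_rhalf]
    split_ifs <;> simp
  · simp [hi]

/-- A unitary of the simulated machine, acting on the simulator's workspace only: `1 ⊗ 1 ⊗ U`. [folklore] -/
def liftGate (N : ℕ) (U : Matrix.unitaryGroup V ℂ) : Matrix.unitaryGroup (Fin N × Bool × V) ℂ :=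
  ⟨(1 : Matrix (Fin N) (Fin N) ℂ) ⊗ₖ ((1 : Matrix Bool Bool ℂ) ⊗ₖ U.1),
    Matrix.kronecker_mem_unitary (Submonoid.one_mem _)
      (Matrix.kronecker_mem_unitary (Submonoid.one_mem _) U.2)⟩

/-- `1 ⊗ 1 ⊗ U` acts on the workspace index only. [cite: BealsEtAl2001, §2] -/
theorem liftGate_mulVec_apply (U : Matrix.unitaryGroup V ℂ) (v : Fin N × Bool × V → ℂ) (s : Fin N × Bool × V) :
    ((liftGate N U).1 *ᵥ v) s = ∑ σ : V, U.1 s.2.2 σ * v (s.1, s.2.1, σ) := by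
  obtain ⟨l, b, w⟩ := s
  rw [liftGate]
  simp only [mulVec, dotProduct, Fintype.sum_prod_type]
  rw [Finset.sum_eq_single l]
  · rw [Finset.sum_eq_single b]
    · refine Finset.sum_congr rfl fun σ _ => ?_
      simp
    · intro b' _ hb'
      refine Finset.sum_eq_zero fun σ _ => ?_
      simp [Ne.symm hb']
    · intro h; exact absurd (Finset.mem_univ _) h
  · intro l' _ hl'
    refine Finset.sum_eq_zero fun c _ => Finset.sum_eq_zero fun w' _ => ?_
    simp [Matrix.one_apply, Ne.symm hl']
  · intro h; exact absurd (Finset.mem_univ _) h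

/-- **Simulated unitaries commute with the embedding**: `(1 ⊗ 1 ⊗ U) ι(ψ) = ι(U ψ)`. [cite: BealsEtAl2001, §2] -/
theorem liftGate_mulVec_embedP (U : Matrix.unitaryGroup V ℂ) (i₀ : Fin N) (ψ : V → ℂ) :
    (liftGate N U).1 *ᵥ embedP i₀ ψ = embedP i₀ (U.1 *ᵥ ψ) := by
  funext ⟨i, b, σ⟩
  rw [liftGate_mulVec_apply, embedP_apply]
  simp only [embedP_apply]
  by_cases hi : i = i₀
  · subst hi
    simp only [if_true, mulVec, dotProduct, Finset.mul_sum]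
    refine Finset.sum_congr rfl fun σ' _ => ?_
    ring
  · simp [hi]

/-- A basis permutation as a unitary gate (its permutation matrix). [folklore] -/
def permUnitary {ι : Type} [Fintype ι] [DecidableEq ι] (π : Equiv.Perm ι) : Matrix.unitaryGroup ι ℂ :=
  ⟨π.permMatrix ℂ, permMatrix_mem_unitaryGroup π⟩

/-- A permutation gate acts by substitution: `(P_π v) s = v (π s)`. [cite: BealsEtAl2001, §2] -/
theorem permUnitary_mulVec {ι : Type} [Fintype ι] [DecidableEq ι] (π : Equiv.Perm ι) (v : ι → ℂ) :
    (permUnitary π).1 *ᵥ v = v ∘ π :=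
  Matrix.permMatrix_mulVec π

end Generic

/-! ### The two permutations of a simulated query -/

section Perms

variable {W : Type}

/-- The simulator's basis: real index, real target, and the whole simulated machine
`Fin M × Bool × W` as workspace. [folklore] -/
abbrev SimBasis (N M : ℕ) (W : Type) : Type := Fin N × Bool × (Fin M × Bool × W)

/-- The swap of a simulated query: at a variable position `τ j = inl i`, exchange the real and the
virtual target and transpose the real index `i₀ ↔ i`; at a constant position do nothing. [folklore] -/
def swapFun (i₀ : Fin N) (τ : Fin M → Fin N ⊕ Bool) (s : SimBasis N M W) : SimBasis N M W :=
  Sum.elim (fun i => (Equiv.swap i₀ i s.1, s.2.2.2.1, (s.2.2.1, s.2.1, s.2.2.2.2))) (fun _ => s) (τ s.2.2.1)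

/-- `swapFun` at a variable position. [cite: AmbainisIraidsSmotrovs2013, Cor. 1 (proof)] -/
theorem swapFun_of_inl (i₀ : Fin N) {τ : Fin M → Fin N ⊕ Bool} {s : SimBasis N M W} {i : Fin N}
    (h : τ s.2.2.1 = Sum.inl i) :
    swapFun i₀ τ s = (Equiv.swap i₀ i s.1, s.2.2.2.1, (s.2.2.1, s.2.1, s.2.2.2.2)) := by
  rw [swapFun, h, Sum.elim_inl]

/-- `swapFun` at a constant position. [cite: AmbainisIraidsSmotrovs2013, Cor. 1 (proof)] -/
theorem swapFun_of_inr (i₀ : Fin N) {τ : Fin M → Fin N ⊕ Bool} {s : SimBasis N M W} {c : Bool}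
    (h : τ s.2.2.1 = Sum.inr c) : swapFun i₀ τ s = s := by
  rw [swapFun, h, Sum.elim_inr]

/-- The swap is an involution. [cite: AmbainisIraidsSmotrovs2013, Cor. 1 (proof)] -/
theorem swapFun_involutive (i₀ : Fin N) (τ : Fin M → Fin N ⊕ Bool) :
    Function.Involutive (swapFun (W := W) i₀ τ) := by
  rintro ⟨i, b, j, b', w⟩
  rcases h : τ j with i' | c
  · have h1 := swapFun_of_inl (W := W) i₀ (s := (i, b, j, b', w)) h
    rw [h1]
    have h2 := swapFun_of_inl (W := W) i₀ (s := (Equiv.swap i₀ i' i, b', j, b, w)) h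
    rw [h2]
    simp
  · rw [swapFun_of_inr i₀ (s := (i, b, j, b', w)) h, swapFun_of_inr i₀ (s := (i, b, j, b', w)) h]

/-- The swap as a permutation of the simulator's basis. [folklore] -/
def swapPerm (i₀ : Fin N) (τ : Fin M → Fin N ⊕ Bool) : Equiv.Perm (SimBasis N M W) :=
  (swapFun_involutive (W := W) i₀ τ).toPerm _

/-- `swapPerm` acts as `swapFun`. [cite: AmbainisIraidsSmotrovs2013, Cor. 1 (proof)] -/
@[simp] theorem swapPerm_apply (i₀ : Fin N) (τ : Fin M → Fin N ⊕ Bool) (s : SimBasis N M W) :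
    swapPerm i₀ τ s = swapFun i₀ τ s := rfl

/-- The constant flip of a simulated query: at a constant position `τ j = inr c` flip the virtual target by
`c`; at a variable position do nothing. [folklore] -/
def flipFun (τ : Fin M → Fin N ⊕ Bool) (s : SimBasis N M W) : SimBasis N M W :=
  (s.1, s.2.1, (s.2.2.1, (s.2.2.2.1 ^^ constOf (τ s.2.2.1)), s.2.2.2.2))

/-- The constant flip is an involution. [cite: AmbainisIraidsSmotrovs2013, Cor. 1 (proof)] -/
theorem flipFun_involutive (τ : Fin M → Fin N ⊕ Bool) : Function.Involutive (flipFun (W := W) τ) := by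
  rintro ⟨i, b, j, b', w⟩
  simp [flipFun]

/-- The constant flip as a permutation of the simulator's basis. [folklore] -/
def flipPerm (τ : Fin M → Fin N ⊕ Bool) : Equiv.Perm (SimBasis N M W) :=
  (flipFun_involutive (W := W) τ).toPerm _

/-- `flipPerm` acts as `flipFun`. [cite: AmbainisIraidsSmotrovs2013, Cor. 1 (proof)] -/
@[simp] theorem flipPerm_apply (τ : Fin M → Fin N ⊕ Bool) (s : SimBasis N M W) :
    flipPerm τ s = (s.1, s.2.1, (s.2.2.1, (s.2.2.2.1 ^^ constOf (τ s.2.2.1)), s.2.2.2.2)) := rfl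

variable [Fintype W] [DecidableEq W]

/-- The swap gate (the permutation matrix of `swapPerm`). [folklore] -/
def swapGate (i₀ : Fin N) (τ : Fin M → Fin N ⊕ Bool) : Matrix.unitaryGroup (SimBasis N M W) ℂ :=
  permUnitary (swapPerm i₀ τ)

/-- The flip gate (the permutation matrix of `flipPerm`). [folklore] -/
def flipGate (τ : Fin M → Fin N ⊕ Bool) : Matrix.unitaryGroup (SimBasis N M W) ℂ :=
  permUnitary (flipPerm τ)

/-- The swap gate acts by substitution along `swapFun`. [cite: AmbainisIraidsSmotrovs2013, Cor. 1 (proof)] -/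
theorem swapGate_mulVec (i₀ : Fin N) (τ : Fin M → Fin N ⊕ Bool) (v : SimBasis N M W → ℂ) :
    (swapGate (W := W) i₀ τ).1 *ᵥ v = v ∘ swapFun i₀ τ :=
  permUnitary_mulVec _ v

/-- The flip gate acts by substitution along `flipFun`. [cite: AmbainisIraidsSmotrovs2013, Cor. 1 (proof)] -/
theorem flipGate_mulVec (τ : Fin M → Fin N ⊕ Bool) (v : SimBasis N M W → ℂ) :
    (flipGate (W := W) τ).1 *ᵥ v = v ∘ flipFun τ :=
  permUnitary_mulVec _ v

/-- **One simulated query.** Swap, query, swap, flip: on the `|+⟩`-resting embedding of `ψ` this is the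
embedding of `O_{liftInput τ x} ψ` — at a variable position the real oracle writes `x_i` into the virtual
target, at a constant position it acts on `|i₀⟩|+⟩` trivially and the flip writes the constant.
[cite: AmbainisIraidsSmotrovs2013, Cor. 1 (proof)] -/
theorem round_embedP (i₀ : Fin N) (τ : Fin M → Fin N ⊕ Bool) (x : Fin N → Bool) (ψ : Fin M × Bool × W → ℂ) :
    (flipGate (W := W) τ).1 *ᵥ ((swapGate (W := W) i₀ τ).1 *ᵥ
      (queryOracle x *ᵥ ((swapGate (W := W) i₀ τ).1 *ᵥ embedP i₀ ψ))) =
      embedP i₀ (queryOracle (liftInput τ x) *ᵥ ψ) := by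
  funext s
  obtain ⟨i, b, j, b', w⟩ := s
  rw [flipGate_mulVec, Function.comp_apply, swapGate_mulVec, Function.comp_apply, queryOracle_mulVec_apply,
    swapGate_mulVec, Function.comp_apply]
  rcases h : τ j with i' | c
  · -- variable position: the flip is trivial, the swaps route `x_i'` into the virtual target
    have hf : flipFun (W := W) τ (i, b, j, b', w) = (i, b, j, b', w) := by
      simp [flipFun, h]
    rw [hf, swapFun_of_inl i₀ (s := (i, b, j, b', w)) h]
    simp only
    rw [swapFun_of_inl i₀ (s := (Equiv.swap i₀ i' i, (b' ^^ x (Equiv.swap i₀ i' i)), j, b, w)) h]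
    simp only [Equiv.swap_apply_self, embedP_apply, queryOracle_mulVec_apply, liftInput_of_inl h]
    by_cases hi : i = i₀
    · subst hi; simp
    · simp [hi]
  · -- constant position: the swaps are trivial, the real query hits `|i₀⟩|+⟩`, the flip writes `c`
    have hf : flipFun (W := W) τ (i, b, j, b', w) = (i, b, j, (b' ^^ c), w) := by
      simp [flipFun, h]
    rw [hf, swapFun_of_inr i₀ (s := (i, b, j, (b' ^^ c), w)) h]
    simp only
    rw [swapFun_of_inr i₀ (s := (i, (b ^^ x i), j, (b' ^^ c), w)) h]
    simp only [embedP_apply, queryOracle_mulVec_apply, liftInput_of_inr h]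

end Perms

/-! ### The simulator -/

section Sim

variable (i₀ : Fin N) (τ : Fin M → Fin N ⊕ Bool) (A : QQueryAlg M)

/-- The gate applied once the `t`-th simulated state is embedded: the swap of the next query while queries
remain, the final Hadamard (`|+⟩ ↦ |0⟩` on the real target) after the last one. [folklore] -/
def preGate (t : ℕ) : Matrix.unitaryGroup (SimBasis N M A.W) ℂ :=
  if t < A.queries then swapGate i₀ τ else hadGate N (Fin M × Bool × A.W)

/-- `preGate t` while queries remain. [cite: AmbainisIraidsSmotrovs2013, Cor. 1 (proof)] -/
theorem preGate_of_lt {t : ℕ} (h : t < A.queries) : preGate i₀ τ A t = swapGate i₀ τ := by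
  rw [preGate, if_pos h]

/-- `preGate` after the last query. [cite: AmbainisIraidsSmotrovs2013, Cor. 1 (proof)] -/
theorem preGate_queries : preGate i₀ τ A A.queries = hadGate N (Fin M × Bool × A.W) := by
  rw [preGate, if_neg (lt_irrefl _)]

/-- The simulator's unitaries: `U'_0 = pre₀ · (1⊗1⊗U_0) · H`, `U'_{j+1} = pre_{j+1} · (1⊗1⊗U_{j+1}) · F · P`.
[folklore] -/
def simUnitary : Fin (A.queries + 1) → Matrix.unitaryGroup (SimBasis N M A.W) ℂ :=
  Fin.cases (preGate i₀ τ A 0 * (liftGate N (A.unitaries 0) * hadGate N (Fin M × Bool × A.W)))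
    fun j => preGate i₀ τ A (j + 1) *
      (liftGate N (A.unitaries j.succ) * (flipGate τ * swapGate i₀ τ))

/-- **The simulator** of `A : QQueryAlg M` on `N` variables along the variable map `τ`, resting the real
index at `i₀`: workspace `Fin M × Bool × A.W`, the same number of queries, accepting `(i₀, 0, σ)` for
`σ ∈ A.accept`. [cite: AmbainisIraidsSmotrovs2013, Cor. 1 (proof)] -/
def simAlg : QQueryAlg N where
  W := Fin M × Bool × A.W
  queries := A.queries
  unitaries := simUnitary i₀ τ A
  start := (i₀, false, A.start)
  accept := {s | s.1 = i₀ ∧ s.2.1 = false ∧ s.2.2 ∈ A.accept}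

/-- The simulator makes as many queries as the simulated machine. [cite: AmbainisIraidsSmotrovs2013, Cor. 1 (proof)] -/
@[simp] theorem simAlg_queries : (simAlg i₀ τ A).queries = A.queries := rfl

/-- The simulator's accepting basis states. [cite: AmbainisIraidsSmotrovs2013, Cor. 1 (proof)] -/
theorem mem_simAlg_accept (s : SimBasis N M A.W) :
    s ∈ (simAlg i₀ τ A).accept ↔ s.1 = i₀ ∧ s.2.1 = false ∧ s.2.2 ∈ A.accept := Iff.rfl

/-- A joint invariant principle for two `Fin.foldl`s run in lockstep. [folklore] -/
private theorem foldl_rel {α β : Type*} (n : ℕ) (f : α → Fin n → α) (g : β → Fin n → β) (a : α) (b : β)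
    (R : ℕ → α → β → Prop) (h0 : R 0 a b)
    (hstep : ∀ (j : Fin n) (a : α) (b : β), R j a b → R (j + 1) (f a j) (g b j)) :
    R n (Fin.foldl n f a) (Fin.foldl n g b) := by
  induction n generalizing R a b with
  | zero => simpa using h0
  | succ n ih =>
    rw [Fin.foldl_succ, Fin.foldl_succ]
    exact ih (fun a i => f a i.succ) (fun b i => g b i.succ) (f a 0) (g b 0) (fun j a b => R (j + 1) a b)
      (hstep 0 a b h0) (fun j a b hj => hstep j.succ a b hj)

/-- **The simulation invariant, at the end**: the simulator's final state at `x` is the `|0⟩`-resting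
embedding of the simulated machine's final state at `liftInput τ x`.
[cite: AmbainisIraidsSmotrovs2013, Cor. 1 (proof)] -/
theorem simAlg_finalState (x : Fin N → Bool) :
    (simAlg i₀ τ A).finalState x = embed0 i₀ (A.finalState (liftInput τ x)) := by
  have key : (simAlg i₀ τ A).finalState x =
      (preGate i₀ τ A A.queries).1 *ᵥ embedP i₀ (A.finalState (liftInput τ x)) := by
    unfold QQueryAlg.finalState
    refine foldl_rel (α := SimBasis N M A.W → ℂ) (β := Fin M × Bool × A.W → ℂ) A.queries
      (fun ψ j => (simUnitary i₀ τ A j.succ).1 *ᵥ (queryOracle x *ᵥ ψ))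
      (fun ψ j => (A.unitaries j.succ).1 *ᵥ (queryOracle (liftInput τ x) *ᵥ ψ))
      ((simUnitary i₀ τ A 0).1 *ᵥ Pi.single (i₀, false, A.start) 1)
      ((A.unitaries 0).1 *ᵥ Pi.single A.start 1)
      (fun t ψB ψA => ψB = (preGate i₀ τ A t).1 *ᵥ embedP i₀ ψA) ?_ ?_
    · -- start: `pre₀ (1⊗1⊗U_0) H |i₀, 0, start⟩ = pre₀ ι(U_0 |start⟩)`
      simp only [simUnitary, Fin.cases_zero, Matrix.UnitaryGroup.mul_val, ← mulVec_mulVec]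
      rw [hadGate_mulVec_single, liftGate_mulVec_embedP]
    · -- one round
      intro j ψB ψA hR
      rw [hR, preGate_of_lt i₀ τ A j.2]
      simp only [simUnitary, Fin.cases_succ, Matrix.UnitaryGroup.mul_val, ← mulVec_mulVec]
      rw [round_embedP, liftGate_mulVec_embedP]
  rw [key, preGate_queries, hadGate_mulVec_embedP]

/-- **The simulator accepts `x` with the probability the simulated machine accepts `liftInput τ x`.**
[cite: AmbainisIraidsSmotrovs2013, Cor. 1 (proof)] -/
theorem simAlg_acceptProb (x : Fin N → Bool) :
    (simAlg i₀ τ A).acceptProb x = A.acceptProb (liftInput τ x) := by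
  classical
  unfold QQueryAlg.acceptProb
  rw [simAlg_finalState]
  set ψ := A.finalState (liftInput τ x)
  show (∑ s ∈ Finset.univ.filter (fun s : SimBasis N M A.W => s ∈ (simAlg i₀ τ A).accept), ‖embed0 i₀ ψ s‖ ^ 2) =
    ∑ σ ∈ Finset.univ.filter (fun σ : Fin M × Bool × A.W => σ ∈ A.accept), ‖ψ σ‖ ^ 2
  rw [Finset.sum_filter, Finset.sum_filter, Fintype.sum_prod_type, Finset.sum_eq_single i₀]
  · rw [Fintype.sum_prod_type, Fintype.sum_bool]
    have ht : ∀ σ : Fin M × Bool × A.W,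
        (if ((i₀, true, σ) : SimBasis N M A.W) ∈ (simAlg i₀ τ A).accept then ‖embed0 i₀ ψ (i₀, true, σ)‖ ^ 2
          else 0) = 0 := fun σ => by
      rw [if_neg]
      rw [mem_simAlg_accept]
      simp
    have hf : ∀ σ : Fin M × Bool × A.W,
        (if ((i₀, false, σ) : SimBasis N M A.W) ∈ (simAlg i₀ τ A).accept then ‖embed0 i₀ ψ (i₀, false, σ)‖ ^ 2
          else 0) = if σ ∈ A.accept then ‖ψ σ‖ ^ 2 else 0 := fun σ => by
      have hm : ((i₀, false, σ) : SimBasis N M A.W) ∈ (simAlg i₀ τ A).accept ↔ σ ∈ A.accept := by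
        rw [mem_simAlg_accept]; simp
      simp only [hm, embed0_apply, and_self, if_true]
    simp only [ht, hf, Finset.sum_const_zero, zero_add]
  · intro i _ hi
    refine Finset.sum_eq_zero fun p _ => ?_
    rw [if_neg]
    rw [mem_simAlg_accept]
    simp [hi]
  · intro h; exact absurd (Finset.mem_univ _) h

/-- **The simulator computes the sub-function**: if `A` computes `f` with error `ε` on `D`, the simulator
computes `x ↦ f (liftInput τ x)` with error `ε` on `liftInput τ ⁻¹' D`.
[cite: AmbainisIraidsSmotrovs2013, Cor. 1 (proof)] -/
theorem simAlg_computesWithError {ε : ℝ} {D : Set (Fin M → Bool)} {f : (Fin M → Bool) → Bool}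
    (hA : A.ComputesWithError ε D f) :
    (simAlg i₀ τ A).ComputesWithError ε {x | liftInput τ x ∈ D} fun x => f (liftInput τ x) := by
  intro x hx
  rw [simAlg_acceptProb]
  exact hA (liftInput τ x) hx

end Sim

/-! ### Consequences for `Q_ε` -/

section Complexity

/-- A constant function costs no queries: for `N ≥ 1` and `0 ≤ ε`, `Q_ε(x ↦ c) = 0` on any promise set
(a `0`-query algorithm that accepts or rejects outright). [cite: BealsEtAl2001, §2] -/
theorem quantumQueryComplexityOn_const (hN : 0 < N) {ε : ℝ} (hε : 0 ≤ ε) (D : Set (Fin N → Bool)) (c : Bool) :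
    quantumQueryComplexityOn ε D (fun _ : Fin N → Bool => c) = 0 := by
  classical
  let A : QQueryAlg N :=
    { W := Unit, queries := 0, unitaries := fun _ => 1, start := (⟨0, hN⟩, false, ()),
      accept := {_s | c = true} }
  have hacc : ∀ x, A.acceptProb x = if c = true then 1 else 0 := by
    intro x
    unfold QQueryAlg.acceptProb QQueryAlg.finalState
    rw [Finset.sum_filter]
    simp only [A, Fin.foldl_zero, Matrix.UnitaryGroup.one_val, one_mulVec, Set.mem_setOf_eq]
    by_cases hc : c = true
    · simp only [hc, if_true]
      rw [Finset.sum_eq_single ((⟨0, hN⟩, false, ()) : Fin N × Bool × Unit)]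
      · simp
      · intro s _ hs; rw [Pi.single_eq_of_ne hs]; simp
      · intro h; exact absurd (Finset.mem_univ _) h
    · simp [hc]
  have hcomp : A.ComputesWithError ε D (fun _ => c) := by
    intro x _
    rw [hacc x]
    constructor
    · intro h; rw [if_pos h]; linarith
    · intro h; rw [if_neg (by simp [h])]; exact hε
  exact Nat.eq_zero_of_le_zero (Nat.sInf_le ⟨A, rfl, hcomp⟩)

/-- `Q_ε(x ↦ c) = 0` for a constant `c` (`N ≥ 1`, `0 ≤ ε`). [cite: BealsEtAl2001, §2] -/
theorem quantumQueryComplexity_const (hN : 0 < N) {ε : ℝ} (hε : 0 ≤ ε) (c : Bool) :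
    quantumQueryComplexity ε (fun _ : Fin N → Bool => c) = 0 :=
  quantumQueryComplexityOn_const hN hε Set.univ c

/-- **Sub-functions cost no more queries (promise version).** For a variable map `τ : Fin M → Fin N ⊕ Bool`
and `0 ≤ ε`, `Q_ε(x ↦ f (liftInput τ x)) ≤ Q_ε(f)`, the left side on the promise set `liftInput τ ⁻¹' D`,
the right side on `D`. [cite: AmbainisIraidsSmotrovs2013, Cor. 1 (proof)] -/
theorem quantumQueryComplexityOn_liftInput_le (τ : Fin M → Fin N ⊕ Bool) {ε : ℝ} (hε : 0 ≤ ε)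
    (D : Set (Fin M → Bool)) (f : (Fin M → Bool) → Bool) :
    quantumQueryComplexityOn ε {x | liftInput τ x ∈ D} (fun x => f (liftInput τ x)) ≤
      quantumQueryComplexityOn ε D f := by
  rcases Nat.eq_zero_or_pos N with rfl | hN
  · rw [quantumQueryComplexityOn_zero_left]; exact Nat.zero_le _
  rcases Nat.eq_zero_or_pos M with rfl | hM
  · -- no variables to substitute: the sub-function is constant
    have hc : (fun x : Fin N → Bool => f (liftInput τ x)) = fun _ => f Fin.elim0 := by
      funext x; congr 1; funext j; exact j.elim0
    rw [hc, quantumQueryComplexityOn_const hN hε]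
    exact Nat.zero_le _
  haveI : NeZero M := NeZero.of_pos hM
  obtain ⟨A, hq, hA⟩ := exists_queries_eq_quantumQueryComplexityOn (N := M) hε D f
  rw [← hq]
  exact Nat.sInf_le ⟨simAlg ⟨0, hN⟩ τ A, rfl, simAlg_computesWithError ⟨0, hN⟩ τ A hA⟩

/-- **Sub-functions cost no more queries: `Q_ε(x ↦ f (liftInput τ x)) ≤ Q_ε(f)`** for every variable map
`τ : Fin M → Fin N ⊕ Bool` (substitute variables or constants for the variables of `f`) and `0 ≤ ε`.
[cite: AmbainisIraidsSmotrovs2013, Cor. 1 (proof)] -/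
theorem quantumQueryComplexity_liftInput_le (τ : Fin M → Fin N ⊕ Bool) {ε : ℝ} (hε : 0 ≤ ε)
    (f : (Fin M → Bool) → Bool) :
    quantumQueryComplexity ε (fun x => f (liftInput τ x)) ≤ quantumQueryComplexity ε f :=
  quantumQueryComplexityOn_liftInput_le τ hε Set.univ f

/-- Identifying or renaming variables costs no more queries: `Q_ε(x ↦ f (x ∘ g)) ≤ Q_ε(f)` for every
`g : Fin M → Fin N`, `0 ≤ ε`. [cite: AmbainisIraidsSmotrovs2013, Cor. 1 (proof)] -/
theorem quantumQueryComplexity_comp_le (g : Fin M → Fin N) {ε : ℝ} (hε : 0 ≤ ε) (f : (Fin M → Bool) → Bool) :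
    quantumQueryComplexity ε (fun x : Fin N → Bool => f (x ∘ g)) ≤ quantumQueryComplexity ε f :=
  quantumQueryComplexity_liftInput_le (Sum.inl ∘ g) hε f

/-- **Relabelling invariance**: along `e : Fin M ≃ Fin N`, `Q_ε(x ↦ f (x ∘ e)) = Q_ε(f)` (`0 ≤ ε`); in
particular `Q_ε` does not depend on how `Fin (a + b)` is identified with `Fin c` for `a + b = c`. [cite: AmbainisIraidsSmotrovs2013, Cor. 1 (proof)] -/
theorem quantumQueryComplexity_comp_equiv (e : Fin M ≃ Fin N) {ε : ℝ} (hε : 0 ≤ ε) (f : (Fin M → Bool) → Bool) :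
    quantumQueryComplexity ε (fun x : Fin N → Bool => f (x ∘ e)) = quantumQueryComplexity ε f := by
  refine le_antisymm (quantumQueryComplexity_comp_le e hε f) ?_
  have hf : f = fun y : Fin M → Bool => (fun x : Fin N → Bool => f (x ∘ e)) (y ∘ e.symm) := by
    funext y
    simp only [Function.comp_assoc, Equiv.symm_comp_self, Function.comp_id]
  conv_lhs => rw [hf]
  exact quantumQueryComplexity_comp_le e.symm hε (fun x : Fin N → Bool => f (x ∘ e))

/-- Padding is a variable map: appending the constants `c` reads `Fin.append x c`. [cite: AmbainisIraidsSmotrovs2013, Cor. 1 (proof)] -/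
theorem liftInput_append (c : Fin M → Bool) (x : Fin N → Bool) :
    liftInput (Fin.append (fun i : Fin N => (Sum.inl i : Fin N ⊕ Bool)) (fun j : Fin M => Sum.inr (c j))) x =
      Fin.append x c := by
  funext j
  refine Fin.addCases (fun i => ?_) (fun k => ?_) j
  · rw [liftInput_apply, Fin.append_left, Fin.append_left, Sum.elim_inl]
  · rw [liftInput_apply, Fin.append_right, Fin.append_right, Sum.elim_inr, id]

/-- **Padding with constants costs no more queries: `Q_ε(x ↦ f (Fin.append x c)) ≤ Q_ε(f)`** for
`f` on `N + M` variables, constants `c : Fin M → Bool`, `0 ≤ ε` ("we append the input `x` with `n − 2k`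
ones producing `x'` and call `EXACT_{n−k}^{2n−2k}(x')`"). [cite: AmbainisIraidsSmotrovs2013, Cor. 1 (proof)] -/
theorem quantumQueryComplexity_append_le (c : Fin M → Bool) {ε : ℝ} (hε : 0 ≤ ε)
    (f : (Fin (N + M) → Bool) → Bool) :
    quantumQueryComplexity ε (fun x : Fin N → Bool => f (Fin.append x c)) ≤ quantumQueryComplexity ε f := by
  have h := quantumQueryComplexity_liftInput_le
    (Fin.append (fun i : Fin N => (Sum.inl i : Fin N ⊕ Bool)) (fun j : Fin M => Sum.inr (c j))) hε f
  simp only [liftInput_append] at h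
  exact h

end Complexity

end Literature.Computability.QuantumComplexity.QueryRestriction

end
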